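import Summits.BirchSwinnertonDyer.Rank1Residual.X12.O11.RamifiedStrictDescentAtThreeLocal
import HarnessLib

/-!
# O11 at `p = 3`, companion II — (R-ctrl)₃ is a THEOREM and (R-tors)₃ follows from
# Gross–Zagier–Kolyvagin: on the displayed sub-leaf of K12r@3 the ONE residual is (R-EU)₃
# (cell `bsd-print-cfram`, D-0131 (2), typer seat `ty2`; sequel of p539796 and of companion I)

HONEST FRAMING (cell `bsd-print-cfram`, HOME `run/shared/lean/pub/bsd-print-cfram/`): THEOREMS ONLY
(no definition, no named fact, no axiom, no `sorry`); nothing about BSD is booked; the `p = 3` slice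
of the leaf K12r (`Summit.BirchSwinnertonDyer.WAllCornerFRamifiedAtThree`) stays OPEN behind (R-EU)₃
(`X12.O11.RamifiedCMEllipticUnitIndexAtThree`, Perrin-Riou's leading-term law for the CM zeta element
at the ramified prime `3`; NOT in print; CONSTRUCTION / OPEN). What is proved — k7r-c4's
`…StrictControlAnyPrime` at `3`, over companion I:

* `ramifiedCMStrictControlAtThree_iff_card` — (R-ctrl)₃ ⟺ its `Λ`-free form (Greenberg Lemma 4.2 on
  the dual pair: `eulerIdentity_of_hasCharValuationAt`, every curve / prime / `ℤ_p`-extension);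
* **`ramifiedCMStrictControlAtThree_holds : RamifiedCMStrictControlAtThree W`** for EVERY elliptic
  `W/ℚ` — exact control ((A𝔭)₃ ⟸ the displayed `ℚ₃`-binders; (Av)₃ displayed) + (D♮)₃ + `ord₃` of a
  product;
* **`ramifiedCMStrictTorsionAtThree_of_GZK : GZK → RamifiedCMStrictTorsionAtThree W`** — under GZK
  both `ℚ`-side strict `3^∞`-Selmer groups are finite at an analytic-rank-one `3`-frame (`W' ∼ W`),
  so `Sel_𝔭(K)` is finite by (D♮)₃, so `H⁰(Γ, Sel_𝔭(K_∞))` is finite by exact control, and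
  Greenberg's criterion + Lemma 4.2 give the shape; NO Euler system / equivariant main conjecture is
  needed for (R-tors)₃ in analytic rank one (the Johnson-Leung–Kings 2011 input named in the typing
  is thereby unnecessary for it);
* `bsdp_three_of_ramifiedCMEllipticUnitIndexAtThree` — the consumer `bsdp_three_of_halves` with
  (R-tors)₃ / (R-ctrl)₃ discharged: `BSD(W, 3)` at an analytic-rank-one `3`-frame ⟸ (R-EU)₃ + the
  displayed frame / generator / local data + {modularity, Gross–Zagier I.(7.3), GZK, Cassels}.
CONDITIONAL only where GZK (`rank_eq_analyticRank_of_analyticRank_le_one`) is a hypothesis.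

References: [GreenbergLNM1716] §1 p. 61, §3 Thm. 1.2, §4 Lemma 4.2 (p. 102); [Kolyvagin1990] Thm. A;
[Darmon2004] Thm. 3.22 (GZK); [DokchitserDokchitserAnnals2010] Lemma 4.14; [Castella2018] Def. 2.2,
Thm. 2.3 (shape); [Cassels1965ArithmeticVIII]; [GrossZagier1986] I.(7.3); [Miller2011LMS] Def. 1.1;
[BurungaleKobayashiNakamuraOta2026] §1.4, Thm. 7.2 (arXiv:2608.06879; claim; preprint; shape only);
[JohnsonLeungKings2011] Thm. 5.2 (named only).
-/

noncomputable section

open scoped Classical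

open WeierstrassCurve NumberField IsDedekindDomain Field PowerSeries
  Literature.NumberTheory.EllipticCurves
  Literature.NumberTheory.EllipticCurves.GreenbergSelmer
  Literature.NumberTheory.EllipticCurves.Rank1Residual
  Literature.NumberTheory.GaloisRepresentations
  Summit.BirchSwinnertonDyer.Rank1Residual
  Summit.BirchSwinnertonDyer.Rank1Residual.Additive
  Summit.BirchSwinnertonDyer.Rank1Residual.X11b
  Summit.BirchSwinnertonDyer.Rank1Residual.X11b.AcSelmer
  Summit.BirchSwinnertonDyer.BirchSwinnertonDyer.Theorems

namespace Summit.BirchSwinnertonDyer.Rank1Residual.X12.O11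

/-! ## §4 (R-ctrl)₃ holds outright; (R-tors)₃ from Gross–Zagier–Kolyvagin -/

section Discharge

variable (W : WeierstrassCurve ℚ) [W.IsElliptic]

/-- **(R-ctrl)₃ ⟺ its `Λ`-free form (R-ctrl)₃♭** (same binders; «`Sel^γ` finite ⟹
`log₃ #Sel^γ = log₃ #Sel_str(W/ℚ)[3^∞] + log₃ #Sel_str(W'/ℚ)[3^∞]`»): Greenberg's Lemma 4.2 on the dual
pair, for every curve / prime / `ℤ_p`-extension (k7r-c4's `eulerIdentity_of_hasCharValuationAt`,
`exists_hasCharValuationAt_and_finite_of_finite`), read at `3`.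
[cite: GreenbergLNM1716, §4 Lemma 4.2 (p. 102)] -/
theorem ramifiedCMStrictControlAtThree_iff_card :
    RamifiedCMStrictControlAtThree W ↔
      ∀ (K : Type) [Field K] [NumberField K] (𝔭 : HeightOneSpectrum (𝓞 K))
        (W' : WeierstrassCurve ℚ) [W'.IsElliptic] [W'.IsGloballyMinimal] (C : VariableChange ℚ),
        IsFrameThree W K 𝔭 W' C → W.analyticRank = 1 →
        ∀ (κ : ZpExtension K 3), κ.IsAnticyclotomic →
          ∀ (γ : absoluteGaloisGroup K) [Fact (κ.IsTopGenerator γ)]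
            (P : W.toAffine.Point) (n : ℕ) (P' : W'.toAffine.Point) (n' : ℕ),
            ¬ IsOfFinAddOrder P →
            (∀ R : W.toAffine.Point, ∃ (k : ℤ) (T : W.toAffine.Point),
              IsOfFinAddOrder T ∧ R = k • P + T) →
            (∀ Q : (W.baseChange ℚ_[3]).toAffine.Point, (3 : ℕ) • Q = 0 → Q = 0) →
            (∃ Q : (W.baseChange ℚ_[3]).toAffine.Point, (3 : ℕ) ^ n • Q = W.toPadicPoint 3 P) →
            (∀ Q : (W.baseChange ℚ_[3]).toAffine.Point,
              (3 : ℕ) ^ (n + 1) • Q ≠ W.toPadicPoint 3 P) →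
            ¬ IsOfFinAddOrder P' →
            (∀ R : W'.toAffine.Point, ∃ (k : ℤ) (T : W'.toAffine.Point),
              IsOfFinAddOrder T ∧ R = k • P' + T) →
            (∀ Q : (W'.baseChange ℚ_[3]).toAffine.Point, (3 : ℕ) • Q = 0 → Q = 0) →
            (∃ Q : (W'.baseChange ℚ_[3]).toAffine.Point, (3 : ℕ) ^ n' • Q = W'.toPadicPoint 3 P') →
            (∀ Q : (W'.baseChange ℚ_[3]).toAffine.Point,
              (3 : ℕ) ^ (n' + 1) • Q ≠ W'.toPadicPoint 3 P') →
            (∀ v : HeightOneSpectrum (𝓞 K), ((3 : ℕ) : 𝓞 K) ∉ v.asIdeal →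
              v.asIdeal.ramificationIdx (𝓞 ℚ) = 1 → v.asIdeal.inertiaDeg (𝓞 ℚ) = 1 →
              (W.baseChange K).HasGoodReductionAt v ∨
                ∀ R : ((W.baseChange K).baseChange (v.adicCompletion K)).toAffine.Point,
                  (3 : ℕ) • R = 0 → R = 0) →
            Finite (IwasawaDual.endInvariants
              (Castella2018.AcSelmer.conjSelmerAc (W.baseChange K) 3 κ 𝔭 ∅ γ - 1)) →
              padicValNat 3 (Nat.card (IwasawaDual.endInvariants
                  (Castella2018.AcSelmer.conjSelmerAc (W.baseChange K) 3 κ 𝔭 ∅ γ - 1))) =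
                padicValNat 3 (Nat.card ↥(strictSelmerPInfty W 3)) +
                  padicValNat 3 (Nat.card ↥(strictSelmerPInfty W' 3)) := by
  constructor
  · intro h K _ _ 𝔭 W' _ _ C hF hr κ hκ γ _ P n P' n' h1 h2 h3 h4 h5 h6 h7 h8 h9 h10 hv hfin
    obtain ⟨n₀, hchar, hfinT⟩ :=
      RamifiedSevenEllipticUnits.exists_hasCharValuationAt_and_finite_of_finite
        (W.baseChange K) 3 κ 𝔭 γ hfin
    have hctrl := h K 𝔭 W' C hF hr κ hκ γ P n P' n' h1 h2 h3 h4 h5 h6 h7 h8 h9 h10 hv n₀ hchar hfinT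
    obtain ⟨-, -, heuler⟩ :=
      RamifiedSevenEllipticUnits.eulerIdentity_of_hasCharValuationAt (W.baseChange K) 3 κ 𝔭 γ hchar
    have heuler' : ((n₀ : ℤ) + padicValNat 3 (Nat.card {x : Castella2018.AcSelmer.XAc
        (W.baseChange K) 3 κ 𝔭 ∅ γ // (PowerSeries.X : IwasawaAlgebra 3) • x = 0})) =
        (padicValNat 3 (Nat.card (IwasawaDual.endInvariants
          (Castella2018.AcSelmer.conjSelmerAc (W.baseChange K) 3 κ 𝔭 ∅ γ - 1))) : ℤ) := by
      exact_mod_cast heuler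
    rw [heuler'] at hctrl
    exact_mod_cast hctrl
  · intro h K _ _ 𝔭 W' _ _ C hF hr κ hκ γ _ P n P' n' h1 h2 h3 h4 h5 h6 h7 h8 h9 h10 hv n₀ hchar _
    obtain ⟨hfin, -, heuler⟩ :=
      RamifiedSevenEllipticUnits.eulerIdentity_of_hasCharValuationAt (W.baseChange K) 3 κ 𝔭 γ hchar
    have hcard := h K 𝔭 W' C hF hr κ hκ γ P n P' n' h1 h2 h3 h4 h5 h6 h7 h8 h9 h10 hv hfin
    have heuler' : ((n₀ : ℤ) + padicValNat 3 (Nat.card {x : Castella2018.AcSelmer.XAc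
        (W.baseChange K) 3 κ 𝔭 ∅ γ // (PowerSeries.X : IwasawaAlgebra 3) • x = 0})) =
        (padicValNat 3 (Nat.card (IwasawaDual.endInvariants
          (Castella2018.AcSelmer.conjSelmerAc (W.baseChange K) 3 κ 𝔭 ∅ γ - 1))) : ℤ) := by
      exact_mod_cast heuler
    rw [heuler']
    exact_mod_cast hcard

/-- **(R-ctrl)₃ is a THEOREM: `RamifiedCMStrictControlAtThree W` for every globally minimal elliptic
`W/ℚ`.** EXACT bottom-layer control at the `3`-frame from (A𝔭)₃ (⟸ the two displayed `ℚ₃`-binders,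
`noThreeTorsion_adicCompletion_of_isFrameThree`) and the displayed degree-one away input
(`strictControl_frameThree_natCard_eq`), the Euler-characteristic form
(`ramifiedCMStrictControlAtThree_iff_card`), and the unconditional count (D♮)₃
(`natCard_selmerAcBase_frameThree_eq_mul`); `ord₃` of a non-zero product is additive. No Euler system,
no `Λ`-module structure theory; no class hypothesis; no named fact. k7r-c4's
`ramifiedCMStrictControlAt_holds`, at `3`. [cite: GreenbergLNM1716, §3 Thm. 1.2 and §4 Lemma 4.2 (p. 102)]
[cite: DokchitserDokchitserAnnals2010, Lemma 4.14 (proof)] -/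
theorem ramifiedCMStrictControlAtThree_holds : RamifiedCMStrictControlAtThree W := by
  rw [ramifiedCMStrictControlAtThree_iff_card]
  intro K _ _ 𝔭 W' _ _ C hF _ κ hκ γ _ P n P' n' _ _ htors _ _ _ _ htors' _ _ hv hfin
  have h𝔭 := noThreeTorsion_adicCompletion_of_isFrameThree W hF htors htors'
  haveI : (W.baseChange K).IsElliptic := by rw [baseChange]; infer_instance
  have hfin' : Finite (selmerAcBase (W.baseChange K) 3 𝔭 ∅) :=
    (strictControl_frameThree_finite_iff hF κ hκ γ h𝔭 hv).mp hfin
  have hcount := natCard_selmerAcBase_frameThree_eq_mul W hF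
  have hne : Nat.card ↥(strictSelmerPInfty W 3) * Nat.card ↥(strictSelmerPInfty W' 3) ≠ 0 := by
    rw [← hcount]
    haveI := hfin'
    exact Nat.card_pos.ne'
  rw [strictControl_frameThree_natCard_eq hF κ hκ γ h𝔭 hv, hcount]
  exact padicValNat.mul (left_ne_zero_of_mul hne) (right_ne_zero_of_mul hne)

/-- **(R-tors)₃ from Gross–Zagier–Kolyvagin alone: `RamifiedCMStrictTorsionAtThree W`** for every
globally minimal `W/ℚ`, CONDITIONAL on the named fact GZK (`rank_eq_analyticRank_of_analyticRank_le_one`,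
hypothesis `hGZK`). At an analytic-rank-one `3`-frame both `ℚ`-side strict `3^∞`-Selmer groups are
finite under GZK (`W' ∼ W`), hence `Sel_𝔭(K, W[3^∞])` is finite by (D♮)₃, hence — exact control from
the displayed local binders — `H⁰(Γ, Sel_𝔭(K_∞, W[3^∞]))` is finite, and Greenberg's criterion +
Lemma 4.2 on the dual pair give the shape at some `n₀` with `X[T]` finite. No Euler system of elliptic
units is needed in analytic rank one (as at `p ≥ 5`, k7r-c3 `ramifiedCMStrictTorsionAt_of_GZK`).
[cite: Kolyvagin1990, Thm. A] [cite: GreenbergLNM1716, §1 p. 61, §3 Thm. 1.2 and §4 Lemma 4.2] -/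
theorem ramifiedCMStrictTorsionAtThree_of_GZK (hGZK : rank_eq_analyticRank_of_analyticRank_le_one) :
    RamifiedCMStrictTorsionAtThree W := by
  intro K _ _ 𝔭 W' _ _ C hF hr κ hκ γ _ htors htors' hv
  haveI : (W.baseChange K).IsElliptic := by rw [baseChange]; infer_instance
  have h𝔭 := noThreeTorsion_adicCompletion_of_isFrameThree W hF htors htors'
  have hr' : W'.analyticRank = 1 := by
    rw [← analyticRank_eq_of_isIsogenous' (isIsogenous_of_isFrameThree hF), hr]
  have hfinW : Finite ↥(strictSelmerPInfty W 3) :=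
    RamifiedSevenEllipticUnits.finite_strictSelmerPInfty_of_GZK hGZK W 3 hr
  have hfinW' : Finite ↥(strictSelmerPInfty W' 3) :=
    RamifiedSevenEllipticUnits.finite_strictSelmerPInfty_of_GZK hGZK W' 3 hr'
  have hbase : Finite (selmerAcBase (W.baseChange K) 3 𝔭 ∅) := by
    refine Nat.finite_of_card_ne_zero ?_
    rw [natCard_selmerAcBase_frameThree_eq_mul W hF]
    exact mul_ne_zero Nat.card_pos.ne' Nat.card_pos.ne'
  have hfin := (strictControl_frameThree_finite_iff hF κ hκ γ h𝔭 hv).mpr hbase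
  obtain ⟨n₀, hn₀, hfinT⟩ :=
    RamifiedSevenEllipticUnits.exists_hasCharValuationAt_and_finite_of_finite
      (W.baseChange K) 3 κ 𝔭 γ hfin
  exact ⟨⟨n₀, hn₀⟩, hfinT⟩

end Discharge

/-! ## §5 The consumer with (R-tors)₃ and (R-ctrl)₃ discharged: `BSD(W, 3)` ⟸ (R-EU)₃ + four facts -/

section Residual

variable {W : WeierstrassCurve ℚ} [W.IsElliptic] [W.IsGloballyMinimal]
  {K : Type} [Field K] [NumberField K] {𝔭 : HeightOneSpectrum (𝓞 K)}
  {W' : WeierstrassCurve ℚ} [W'.IsElliptic] [W'.IsGloballyMinimal] {C : VariableChange ℚ}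
  {κ : ZpExtension K 3} {P : W.toAffine.Point} {n : ℕ} {P' : W'.toAffine.Point} {n' : ℕ}

/-- **`BSD(W, 3)` at an analytic-rank-one `3`-frame from (R-EU)₃ alone + four named facts**:
`bsdp_three_of_halves` with `h1 := ramifiedCMStrictTorsionAtThree_of_GZK hGZK W` and
`h2 := ramifiedCMStrictControlAtThree_holds W`; displayed: the frame, `r_an(W) = 1`, anticyclotomic
`κ` with topological generator `γ`, generators `P`, `P'` modulo torsion with their `3`-divisibility
levels, NO `3`-torsion in `W(ℚ₃)`, `W'(ℚ₃)`, the degree-one away input, and modularity (`hmod`),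
Gross–Zagier I.(7.3) (`hGZ`), GZK (`hGZK`), Cassels (`hCassels`). So on the displayed sub-leaf of
K12r@3 the corner's ONE residual input is (R-EU)₃ — Perrin-Riou's leading-term law for the CM zeta
element at the ramified prime `3`, CONSTRUCTION / OPEN; nothing is asserted about it.
[cite: BurungaleKobayashiNakamuraOta2026, §1.4 (arXiv:2608.06879 p. 8) (claim; preprint; shape only; `p ≥ 5` there)]
[cite: Cassels1965ArithmeticVIII] [cite: GrossZagier1986, Thm. I.(7.3)] [cite: Miller2011LMS, Def. 1.1] -/
theorem bsdp_three_of_ramifiedCMEllipticUnitIndexAtThree (hmod : hasEntireLFunction_rat)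
    (hGZ : GrossZagier1986_thm_I_7_3) (hGZK : rank_eq_analyticRank_of_analyticRank_le_one)
    (hCassels : bsdRHS_eq_of_isIsogenous) (h3 : RamifiedCMEllipticUnitIndexAtThree W)
    (hF : IsFrameThree W K 𝔭 W' C) (hr : W.analyticRank = 1)
    (hκ : κ.IsAnticyclotomic) (γ : absoluteGaloisGroup K) [Fact (κ.IsTopGenerator γ)]
    (hP : ¬ IsOfFinAddOrder P)
    (hgen : ∀ R : W.toAffine.Point, ∃ (k : ℤ) (T : W.toAffine.Point),
      IsOfFinAddOrder T ∧ R = k • P + T)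
    (htors : ∀ Q : (W.baseChange ℚ_[3]).toAffine.Point, (3 : ℕ) • Q = 0 → Q = 0)
    (hdiv : ∃ Q : (W.baseChange ℚ_[3]).toAffine.Point, (3 : ℕ) ^ n • Q = W.toPadicPoint 3 P)
    (hndiv : ∀ Q : (W.baseChange ℚ_[3]).toAffine.Point, (3 : ℕ) ^ (n + 1) • Q ≠ W.toPadicPoint 3 P)
    (hP' : ¬ IsOfFinAddOrder P')
    (hgen' : ∀ R : W'.toAffine.Point, ∃ (k : ℤ) (T : W'.toAffine.Point),
      IsOfFinAddOrder T ∧ R = k • P' + T)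
    (htors' : ∀ Q : (W'.baseChange ℚ_[3]).toAffine.Point, (3 : ℕ) • Q = 0 → Q = 0)
    (hdiv' : ∃ Q : (W'.baseChange ℚ_[3]).toAffine.Point, (3 : ℕ) ^ n' • Q = W'.toPadicPoint 3 P')
    (hndiv' : ∀ Q : (W'.baseChange ℚ_[3]).toAffine.Point,
      (3 : ℕ) ^ (n' + 1) • Q ≠ W'.toPadicPoint 3 P')
    (hv : ∀ v : HeightOneSpectrum (𝓞 K), ((3 : ℕ) : 𝓞 K) ∉ v.asIdeal →
      v.asIdeal.ramificationIdx (𝓞 ℚ) = 1 → v.asIdeal.inertiaDeg (𝓞 ℚ) = 1 →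
      (W.baseChange K).HasGoodReductionAt v ∨
        ∀ R : ((W.baseChange K).baseChange (v.adicCompletion K)).toAffine.Point,
          (3 : ℕ) • R = 0 → R = 0) :
    BSDp W 3 :=
  bsdp_three_of_halves hmod hGZ hGZK hCassels (ramifiedCMStrictTorsionAtThree_of_GZK W hGZK)
    (ramifiedCMStrictControlAtThree_holds W) h3 hF hr hκ γ hP hgen htors hdiv hndiv hP' hgen' htors'
    hdiv' hndiv' hv

end Residual

end Summit.BirchSwinnertonDyer.Rank1Residual.X12.O11

end
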